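import Mathlib
import Literature.NumberTheory.Transcendental.KZProduct
import Literature.NumberTheory.Transcendental.KZCalculusProofs
import Literature.NumberTheory.Transcendental.KZVolumeConjectureProofs
import Literature.NumberTheory.Transcendental.SemialgebraicMapsProofs
import Summits.KontsevichZagierPeriods.KontsevichZagierPeriods.Theorems.SoloInformedPolyJacobian
import HarnessLib
import HarnessLib.Audit

/-!
# SoloInformed — dilations along one axis inside the calculus

For a volume representation `[σ, 1]` of dimension `3` with compact domain and a natural number
`c ≥ 1`, the dilate `Φ_c σ`, `Φ_c(x, y, z) = (x, y, c z)`, satisfies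
`[Φ_c σ, 1] − c · [σ, 1] ∈ relations` (`soloInformed_stretchRep_sub_nsmul_mem_relations`): rule (2)
for the polynomial diffeomorphism `Φ_c` (`|det Φ_c'| = c`) gives `[σ, c] ∼ [Φ_c σ, 1]`, and integrand
additivity (rule (1)) gives `[σ, c] ∼ c · [σ, 1]`. The dilate is again a compact solid with non-empty
interior (`isCompact_soloInformedStretchRep_domain`, `soloInformed_interior_stretchRep_nonempty`) of
volume `c · vol σ` (`soloInformed_value_stretchRep`). This is how rational multiples of volumes are
realised by honest solids when a volume rung is applied (`SoloInformedTorusInstance`).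

Residency `solo-KontsevichZagierPeriods-informed` (PLAN.md, session s16).
References: M. Kontsevich, D. Zagier, *Periods* (2001), §1.2 (rules (1)–(2)).
-/

noncomputable section

open MeasureTheory Set Filter
open scoped Topology

namespace Summit.KontsevichZagierPeriods.KontsevichZagierPeriods.Theorems

open Literature.NumberTheory.Transcendental Literature.NumberTheory.Transcendental.KZ
open Literature.ModelTheory.ExponentialFields (IsSemialgebraic isSemialgebraic_setOf_eval_le
  isSemialgebraic_setOf_eval_lt)

/-! ### Dilations along the last coordinate -/

/-- `Φ_c(x, y, z) = (x, y, c z)` as polynomials. -/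
def soloInformedZScalePoly (c : ℕ) : Fin 3 → MvPolynomial (Fin 3) ℚ :=
  ![MvPolynomial.X 0, MvPolynomial.X 1, MvPolynomial.C (c : ℚ) * MvPolynomial.X 2]

/-- The dilation `Φ_c(x, y, z) = (x, y, c z)`. -/
def soloInformedZScale (c : ℕ) : (Fin 3 → ℝ) → (Fin 3 → ℝ) :=
  soloInformedPolyMap (soloInformedZScalePoly c)

/-- Components of `Φ_c`. -/
@[simp] theorem soloInformedZScale_apply_zero (c : ℕ) (u : Fin 3 → ℝ) :
    soloInformedZScale c u 0 = u 0 := by simp [soloInformedZScale, soloInformedZScalePoly]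

/-- Components of `Φ_c`. -/
@[simp] theorem soloInformedZScale_apply_one (c : ℕ) (u : Fin 3 → ℝ) :
    soloInformedZScale c u 1 = u 1 := by simp [soloInformedZScale, soloInformedZScalePoly]

/-- Components of `Φ_c`. -/
@[simp] theorem soloInformedZScale_apply_two (c : ℕ) (u : Fin 3 → ℝ) :
    soloInformedZScale c u 2 = (c : ℝ) * u 2 := by simp [soloInformedZScale, soloInformedZScalePoly]

/-- `Φ_c` is continuous. -/
theorem soloInformed_continuous_zScale (c : ℕ) : Continuous (soloInformedZScale c) :=
  continuous_iff_continuousAt.2 fun u =>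
    (soloInformed_hasFDerivAt_polyMap (soloInformedZScalePoly c) u).continuousAt

/-- `det Φ_c' = c`. -/
theorem soloInformed_det_zScale (c : ℕ) (u : Fin 3 → ℝ) :
    (soloInformedJacCLM (soloInformedZScalePoly c) u).det = c := by
  rw [soloInformed_det_jacCLM, Matrix.det_fin_three]
  simp [soloInformedJacMat_apply, soloInformedZScalePoly]

/-- For `c ≠ 0`, the image of a set under `Φ_c` is its preimage under `(x, y, z) ↦ (x, y, z / c)`. -/
theorem soloInformedZScale_image (c : ℕ) (hc : c ≠ 0) (A : Set (Fin 3 → ℝ)) :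
    soloInformedZScale c '' A = (fun x : Fin 3 → ℝ => ![x 0, x 1, (c : ℝ)⁻¹ * x 2]) ⁻¹' A := by
  have hc' : (c : ℝ) ≠ 0 := Nat.cast_ne_zero.2 hc
  ext x
  constructor
  · rintro ⟨y, hy, rfl⟩
    have e : (![soloInformedZScale c y 0, soloInformedZScale c y 1,
        (c : ℝ)⁻¹ * soloInformedZScale c y 2] : Fin 3 → ℝ) = y := by
      ext j
      fin_cases j
      · simp
      · simp
      · simp [hc']
    show (![soloInformedZScale c y 0, soloInformedZScale c y 1,
        (c : ℝ)⁻¹ * soloInformedZScale c y 2] : Fin 3 → ℝ) ∈ A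
    rw [e]
    exact hy
  · intro hx
    refine ⟨![x 0, x 1, (c : ℝ)⁻¹ * x 2], hx, ?_⟩
    ext j
    fin_cases j
    · simp
    · simp
    · simp [hc']

/-- `[σ, c]`: the domain of a volume representation weighted by the constant `c`. -/
def soloInformedWeightRep (r : IntegralRep 3) (hr : IsCompact r.domain) (c : ℕ) : IntegralRep 3 where
  domain := r.domain
  integrand _ := (c : ℝ)
  isSemialgebraic_domain := r.isSemialgebraic_domain
  isSemialgebraicFunOn_integrand := isSemialgebraicFunOn_natCast r.isSemialgebraic_domain c
  integrableOn := continuous_const.continuousOn.integrableOn_compact hr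

/-- `Φ_c σ` is `ℚ`-semialgebraic (Tarski–Seidenberg). -/
theorem isSemialgebraic_soloInformedZScale_image (r : IntegralRep 3) (c : ℕ) :
    IsSemialgebraic ℚ (soloInformedZScale c '' r.domain) :=
  IsSemialgebraicMapOn.isSemialgebraic_image_holds
    (isSemialgebraicMapOn_aeval r.isSemialgebraic_domain (soloInformedZScalePoly c)) Subset.rfl
    r.isSemialgebraic_domain

/-- `[Φ_c σ, 1]`: the dilated solid. -/
def soloInformedStretchRep (r : IntegralRep 3) (hr : IsCompact r.domain) (c : ℕ) : IntegralRep 3 where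
  domain := soloInformedZScale c '' r.domain
  integrand _ := 1
  isSemialgebraic_domain := isSemialgebraic_soloInformedZScale_image r c
  isSemialgebraicFunOn_integrand := by
    simpa using isSemialgebraicFunOn_ratCast (isSemialgebraic_soloInformedZScale_image r c) 1
  integrableOn := continuous_const.continuousOn.integrableOn_compact
    (hr.image (soloInformed_continuous_zScale c))

/-- The dilated solid is compact. -/
theorem isCompact_soloInformedStretchRep_domain (r : IntegralRep 3) (hr : IsCompact r.domain)
    (c : ℕ) : IsCompact (soloInformedStretchRep r hr c).domain :=
  hr.image (soloInformed_continuous_zScale c)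

/-- The dilated solid has non-empty interior if the solid has (`c ≠ 0`). -/
theorem soloInformed_interior_stretchRep_nonempty (r : IntegralRep 3) (hr : IsCompact r.domain)
    (c : ℕ) (hc : c ≠ 0) (hri : (interior r.domain).Nonempty) :
    (interior (soloInformedStretchRep r hr c).domain).Nonempty := by
  obtain ⟨x, hx⟩ := hri
  have hopen : IsOpen (soloInformedZScale c '' interior r.domain) := by
    rw [soloInformedZScale_image c hc]
    refine isOpen_interior.preimage (continuous_pi fun i => ?_)
    fin_cases i
    · simpa using continuous_apply 0
    · simpa using continuous_apply 1
    · show Continuous fun a : Fin 3 → ℝ => (c : ℝ)⁻¹ * a 2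
      exact continuous_const.mul (continuous_apply 2)
  refine ⟨soloInformedZScale c x, interior_mono (image_mono interior_subset) ?_⟩
  rw [hopen.interior_eq]
  exact mem_image_of_mem _ hx

/-- Rule (2) for `Φ_c`: `[σ, c] − [Φ_c σ, 1] ∈ relations` (`c ≠ 0`). -/
theorem soloInformed_weightRep_sub_stretchRep_mem_relations (r : IntegralRep 3)
    (hr : IsCompact r.domain) (c : ℕ) (hc : c ≠ 0) :
    of (soloInformedWeightRep r hr c) - of (soloInformedStretchRep r hr c) ∈ relations := by
  have hc' : (c : ℝ) ≠ 0 := Nat.cast_ne_zero.2 hc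
  refine changeOfVariablesRel_subset_relations ⟨3, soloInformedWeightRep r hr c,
    soloInformedStretchRep r hr c, soloInformedZScale c, soloInformedJacCLM (soloInformedZScalePoly c),
    isSemialgebraicMapOn_aeval r.isSemialgebraic_domain (soloInformedZScalePoly c),
    fun u _ => (soloInformed_hasFDerivAt_polyMap (soloInformedZScalePoly c) u).hasFDerivWithinAt,
    ?_, rfl, fun u _ => ?_, rfl⟩
  · intro u _ v _ huv
    have e0 : u 0 = v 0 := by simpa using congr_fun huv 0
    have e1 : u 1 = v 1 := by simpa using congr_fun huv 1
    have e2 : (c : ℝ) * u 2 = (c : ℝ) * v 2 := by simpa using congr_fun huv 2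
    ext j
    fin_cases j
    · exact e0
    · exact e1
    · exact mul_left_cancel₀ hc' e2
  · show (c : ℝ) = 1 * |(soloInformedJacCLM (soloInformedZScalePoly c) u).det|
    rw [soloInformed_det_zScale, abs_of_nonneg (Nat.cast_nonneg c), one_mul]

/-- Integrand additivity: `[σ, c] − c · [σ, 1] ∈ relations` for a volume representation. -/
theorem soloInformed_weightRep_sub_nsmul_mem_relations (r : IntegralRep 3) (hr : IsCompact r.domain)
    (hr1 : ∀ x ∈ r.domain, r.integrand x = 1) :
    ∀ c : ℕ, of (soloInformedWeightRep r hr c) - c • of r ∈ relations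
  | 0 => by
      have h := integrandAddRel_subset_relations ⟨3, soloInformedWeightRep r hr 0,
        soloInformedWeightRep r hr 0, soloInformedWeightRep r hr 0, rfl, rfl,
        fun z _ => by simp [soloInformedWeightRep], rfl⟩
      have h' : -of (soloInformedWeightRep r hr 0) ∈ relations := by
        have e : of (soloInformedWeightRep r hr 0) - of (soloInformedWeightRep r hr 0) -
            of (soloInformedWeightRep r hr 0) = -of (soloInformedWeightRep r hr 0) := by abel
        rw [← e]; exact h
      simpa using relations.neg_mem h'
  | c + 1 => by
      have step := integrandAddRel_subset_relations ⟨3, soloInformedWeightRep r hr (c + 1),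
        soloInformedWeightRep r hr c, r, rfl, rfl, fun z hz => by
          show ((c + 1 : ℕ) : ℝ) = (c : ℝ) + r.integrand z
          rw [hr1 z hz]; push_cast; ring, rfl⟩
      have ih := soloInformed_weightRep_sub_nsmul_mem_relations r hr hr1 c
      have e : of (soloInformedWeightRep r hr (c + 1)) - (c + 1) • of r =
          (of (soloInformedWeightRep r hr (c + 1)) - of (soloInformedWeightRep r hr c) - of r) +
          (of (soloInformedWeightRep r hr c) - c • of r) := by
        rw [add_nsmul, one_nsmul]; abel
      rw [e]
      exact relations.add_mem step ih

/-- **Dilation.** `[Φ_c σ, 1] − c · [σ, 1] ∈ relations` for a volume representation (`c ≠ 0`). -/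
theorem soloInformed_stretchRep_sub_nsmul_mem_relations (r : IntegralRep 3) (hr : IsCompact r.domain)
    (hr1 : ∀ x ∈ r.domain, r.integrand x = 1) (c : ℕ) (hc : c ≠ 0) :
    of (soloInformedStretchRep r hr c) - c • of r ∈ relations := by
  have h1 := soloInformed_weightRep_sub_stretchRep_mem_relations r hr c hc
  have h2 := soloInformed_weightRep_sub_nsmul_mem_relations r hr hr1 c
  have e : of (soloInformedStretchRep r hr c) - c • of r =
      (of (soloInformedWeightRep r hr c) - c • of r) -
      (of (soloInformedWeightRep r hr c) - of (soloInformedStretchRep r hr c)) := by abel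
  rw [e]
  exact relations.sub_mem h2 h1

/-- `vol(Φ_c σ) = c · vol(σ)`. -/
theorem soloInformed_value_stretchRep (r : IntegralRep 3) (hr : IsCompact r.domain)
    (hr1 : ∀ x ∈ r.domain, r.integrand x = 1) (c : ℕ) (hc : c ≠ 0) :
    (soloInformedStretchRep r hr c).value = c * r.value := by
  have h := eval_eq_zero_of_mem_relations
    (soloInformed_stretchRep_sub_nsmul_mem_relations r hr hr1 c hc)
  simp only [map_sub, map_nsmul, eval_of, nsmul_eq_mul] at h
  linarith

end Summit.KontsevichZagierPeriods.KontsevichZagierPeriods.Theorems
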